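import Summits.QuantumFields.YangMills.Theorems.Y2BridgeKing

/-!
# OSLegsAtWeakCouplingC / Y2Bridge (2/3) — the bridge `YangMills ⇐ UV ∧ NT ∧ IR ∧ ROT` (and `… ∧ KING Θ`); sequential IR leg

HONEST FRAMING (cell `ym-beyond`, seat P2 «strong-coupling bridge», HUMAN RULING D-0035 / D-0037; tree edition g9,
2026-08-25, module 2 of 3 of the farm-checked HOME text `ROUTE-P2-Lift-Y2Bridge.lean` sha16 88dea3089e2d7187 = sketches
`ROUTE-P2-SketchY2v2.lean` 41ff3c804614185f + `ROUTE-P2-SketchSeq.lean` 71a1ab5bc548f5fc, referee baseline v0.7 PASS; memo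
`HOME/ROUTE-P2.md` §4f, §5; filed for the cell by the courier seat `ym-beyond-courier` per director-ym lines №1 (A), №3 (C)).  SUMMIT-SIDE SUPPORT
for the lead of crux `OSLegsAtWeakCouplingC`: NOTHING here is asserted about Yang–Mills — every binder is a HYPOTHESIS,
a statement about LATTICE Yang–Mills alone (Wilson's measure on odd tori `(ℤ/(2L+1))⁴`, tree coupling `β`, unit map
`a : ℝ → ℝ`) taken verbatim from the tree (`Cruxes.OSLegsFromFemtoAndGap.DlrCollarTransfer.*`,
`Theorems/LangevinControlUVOSLegsFromFemtoAndGapDefs.lean`, `…AtWeakCouplingCSketchRetype.lean`); every arrow is a TREE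
theorem used by name; no item is tagged or registered (the route owner's call).  NO `sorry`, no axiom beyond the
standard three.  WHAT THIS IS NOT: not a proof of any leg, not THE NUMBER (memo §2), not the venture-side door modules
(`Summits/Ventures/YMGap/YM4Door/*`).

CONTENTS.  §OneGroup: at ONE compact gauge group, from `UV ∧ NT ∧ IR` and any germ mechanism (`osDataWithGap_of_legs_germ`;
instances `…_of_legs` from `ROT`, `…_of_legs_king` from `KING Θ` with `Θ` generating a dense subgroup) — OS data that IS
Yang–Mills for `r` along a scheme in units `a`, non-trivial, non-Gaussian, WITH the continuum mass gap AND the lattice mass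
gap at a common rate (the tree's `conclC_of_legs_latticeWard` re-run KEEPING the gap it derives and drops; final step
through the Literature theorem `exists_yangMillsWitness_of_oneSpecies`).  §Clay: `yangMills_of_legs :
(∀ G compact simple, ∃ r a, a > 0 ∧ a → 0 ∧ UV ∧ NT ∧ IR ∧ ROT) → YangMills` — conclusion the tree's `_root_.YangMills`
literally; `yangMills_of_legs_king`, `yangMills_of_legs_kingPyth` (King's Pythagorean angles); `scheme_in_units_of_legs`
(units clause kept).  §Seq (memo F-k): the Track-A apex delivers its conclusions PER TUNED SEQUENCE of bare couplings,
whereas `GapInUnits` quantifies over ALL `β ≥ β₂`: `GapInUnitsSeq` is the sequential form, `gapInUnitsSeq_of_gapInUnits`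
the trivial direction (the converse is FALSE in general — a unit map read off one sequence says nothing at the other
couplings), `gapInUnitsSeq_of_forall` the shape a per-sequence deliverer produces.
PREVIOUS: `Y2BridgeKing.lean` (binders, King leg).  NEXT: `Y2BridgeWindow.lean` (the P2 window inside the bridge).

References: K. Osterwalder, E. Seiler, Ann. Phys. 110 (1978) 440–471; C. King, CMP 103 (1986) 323–349; the tree files above.
-/

set_option autoImplicit false

noncomputable section

open scoped SchwartzMap ComplexConjugate BigOperators
open MeasureTheory Filter Topology
open Literature.MathematicalPhysics.QuantumFieldTheory Literature.MathematicalPhysics.QuantumLattice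
open Literature.MathematicalPhysics.AQFT Literature.Probability.LatticeModels
open Summit.QuantumFields.YangMills.Cruxes.OSLegsFromFemtoAndGap.DlrCollarTransfer
open Summit.QuantumFields.YangMills.Cruxes.OSLegsAtWeakCouplingC.Sketch
open Summit.QuantumFields.YangMills.Theorems.OSLegsFromFemtoAndGap (isHermitian_of_isReflectionPositive latticeDist)
open Summit.QuantumFields.YangMills.Theorems.HypercubicLimit.Negative (onlySpecies latticeSchwinger_onlySpecies_self)
open Summit.QuantumFields.YangMills.Theorems.NPointIsotropy.Negative (E4)

namespace Summit.QuantumFields.YangMills.Cruxes.OSLegsAtWeakCouplingC.Y2Bridge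

/-! ## The bridge at one gauge group: OS data WITH the continuum gap, at a common rate -/

section OneGroup

variable {G : Type} [Group G] [TopologicalSpace G] [IsTopologicalGroup G] [CompactSpace G]
  [MeasurableSpace G] [BorelSpace G]

/-- **OS data with BOTH gaps from UV, NT, IR and ANY germ mechanism** (any compact `G`, any `r`, any positive unit
map `a → 0`): the E1 input is abstracted to "every soft-bundle limit along the scheme with bounded densities off the
diagonal has a det-1 planar-invariant germ" (`hGERM`), which the lattice Ward leg `ROT` (`germRotAt_of_latticeWardAt`)
and the King leg `KING Θ` (`King.germRotAt_of_latticeKingAt`) both supply.  The tree's `conclC_of_legs_latticeWard`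
re-run keeping the continuum gap: the rope's `Decay Δ` gives `S₁.HasMassGap Δ` (`stub_gap`), the bundle gives
`HasLatticeMassGap r sch Δ'`, both hold at `min Δ Δ'`, and the one-field family extends by zero to Yang–Mills OS data
along the silenced scheme (`exists_yangMillsWitness_of_oneSpecies`). -/
theorem osDataWithGap_of_legs_germ (r : LatticeRep G) (a : ℝ → ℝ) (hapos : ∀ β, 0 < a β)
    (ha0 : Tendsto a atTop (𝓝 0)) (hUV : UV G r a) (hNT : NT G r a) (hIR : IR G r a)
    (hGERM : ∀ (sch : SpeciesScheme (YMSpecies G)) (S₁ : SchwingerFamily E4)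
      (Tq : (n : ℕ) → (Fin n → Fin 4 × Fin 4) → (𝓢((Fin n → E4), ℂ) →L[ℂ] ℂ)) (K b₀ : ℝ) (g : ℝ → ℕ → ℕ),
      SoftBundle G r a sch S₁ Tq K b₀ g → OffDiagDensity S₁ →
        ∃ r₁ : ℝ, 0 < r₁ ∧ ∀ R : E4 ≃ₗᵢ[ℝ] E4, LinearMap.det (R.toLinearEquiv : E4 →ₗ[ℝ] E4) = 1 →
          IsPlanar01 R → GermInvariant S₁ R r₁) :
    ∃ (sch : SpeciesScheme (YMSpecies G)) (T : OSData (YMSpecies G) 4),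
      (∀ k, sch.a k = a (sch.β k)) ∧ sch.HasWeakCouplingLimit ∧ IsYangMillsFor r sch T ∧
        T.IsNontrivial r.curvature ∧ T.IsNonGaussian r.curvature ∧
        ∃ Δ > 0, T.HasMassGap Δ ∧ HasLatticeMassGap r sch Δ := by
  -- the rope's demands, then the soft bundle meeting them (compactness + inheritance: `stub_growth`)
  obtain ⟨b₀, g, Δ, hΔ, hRD⟩ := stub_rope G r a hapos ha0 hIR
  obtain ⟨sch, S₁, Tq, K, hB⟩ := stub_growth G r a hapos ha0 hUV hNT hIR b₀ g
  obtain ⟨hRP, hDec⟩ := hRD sch S₁ Tq K hB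
  have hsigned : ∀ R : E4 ≃ₗᵢ[ℝ] E4, IsSignedPerm R → Invariant S₁ R :=
    fun R hR n F hF => stub_hypercubic G r a sch S₁ Tq K b₀ g hB n R hR F hF
  have hdens : OffDiagDensity S₁ := stub_density G r a sch S₁ Tq K b₀ g hUV hB
  -- unpack the bundle
  obtain ⟨⟨hunits, -, -, hβ, hN, hLG, hE3, htrans, h0, h1', -, -, hYM, hnt, hng, ⟨Δ', hΔ', hlat⟩, hranges, -⟩, -⟩ :=
    id hB
  -- E1: det-1 planar germ invariance (from the abstract mechanism) ⇒ planar invariance ⇒ SO(4)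
  obtain ⟨r₁, hr₁, hgermR⟩ := hGERM sch S₁ Tq K b₀ g hB hdens
  -- continuum side
  obtain ⟨hCS, hgapOf⟩ := stub_gap S₁ h0 htrans hRP
  have hE4 : S₁.toLabelled.HasClusterProperty :=
    stub_cluster S₁ Δ hΔ h0 h1' htrans (fun n R hR F hF => hsigned R hR n F hF) hCS hDec
  have hplanar : ∀ R : E4 ≃ₗᵢ[ℝ] E4, LinearMap.det (R.toLinearEquiv : E4 →ₗ[ℝ] E4) = 1 → IsPlanar01 R →
      Invariant S₁ R := fun R hdet hR =>
    stub_locality S₁ h0 htrans hE3 hLG hRP hsigned hdens R hR r₁ hr₁ (hgermR R hdet hR)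
  have hE1 : S₁.toLabelled.IsEuclideanInvariant := isEuclideanInvariant_of_planarRot S₁ htrans hsigned hplanar
  have hE2 : S₁.toLabelled.IsReflectionPositive := isReflectionPositive_of_rpPos hRP
  have hherm : S₁.toLabelled.IsHermitian := isHermitian_of_isReflectionPositive S₁ hN hE2
  have hOS : OSAxiomsSchwinger S₁.toLabelled :=
    { normalized := hN, hermitian := hherm, invariant := hE1, reflectionPositive := hE2, symmetric := hE3,
      cluster := hE4, linearGrowth := hLG }
  -- the continuum gap the tree derives and drops, and the common rate
  have hgap : S₁.toLabelled.HasMassGap Δ := hgapOf Δ hΔ hDec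
  have hΔ₀ : 0 < min Δ Δ' := lt_min hΔ hΔ'
  have hgap₀ : S₁.toLabelled.HasMassGap (min Δ Δ') := hasMassGap_anti hgap (min_le_left _ _)
  have hlat₀ : HasLatticeMassGap r sch (min Δ Δ') := hasLatticeMassGap_anti r sch hlat (min_le_right _ _)
  -- one OS field (species `Unit`), then extension by zero along the silenced scheme
  have hc : ∀ s : YMSpecies G, s ≠ r.curvature → ∀ k, (onlySpecies sch r.curvature).c s k = 0 := by
    intro s hs k
    simp [onlySpecies, hs]
  have hconv : ∀ n : ℕ, n ≠ 0 → ∀ (f : Fin n → 𝓢(E4, ℝ)) (F : 𝓢((Fin n → E4), ℂ)),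
      IsTensorOf F (fun i => ofRealTest (f i)) → IsOffDiagonal F →
        Tendsto (fun k : ℕ => ((latticeSchwinger r.ρ (onlySpecies sch r.curvature) (fun s => s.F) k n
          (fun _ => r.curvature) f : ℝ) : ℂ)) atTop
          (𝓝 ((OSData.ofAxioms S₁.toLabelled hOS).schwinger n (fun _ => ()) F)) := by
    intro n hn f F hF hod
    simp_rw [latticeSchwinger_onlySpecies_self]
    rw [OSData.ofAxioms_schwinger, SchwingerFamily.toLabelled_apply]
    exact hYM n hn f F hF hod
  have hNT' : (OSData.ofAxioms S₁.toLabelled hOS).IsNontrivial () := by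
    unfold OSData.IsNontrivial
    simpa only [OSData.ofAxioms_schwinger] using hnt
  have hNG' : (OSData.ofAxioms S₁.toLabelled hOS).IsNonGaussian () := by
    unfold OSData.IsNonGaussian
    simpa only [OSData.ofAxioms_schwinger] using hng
  have hgapT : (OSData.ofAxioms S₁.toLabelled hOS).HasMassGap (min Δ Δ') := by
    unfold OSData.HasMassGap
    simpa only [OSData.ofAxioms_schwinger] using hgap₀
  obtain ⟨T, hYM', hntT, hngT, Δ₁, hΔ₁, hgapT', hlatT⟩ :=
    exists_yangMillsWitness_of_oneSpecies r (onlySpecies sch r.curvature) hc (OSData.ofAxioms S₁.toLabelled hOS)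
      hconv hNT' hNG' hΔ₀ hgapT hlat₀
  exact ⟨onlySpecies sch r.curvature, T, hunits, hβ, hYM', hntT, hngT, Δ₁, hΔ₁, hgapT', hlatT⟩

/-- **OS data with BOTH gaps from the four lattice legs `UV ∧ NT ∧ IR ∧ ROT`** (lattice rotation-Ward form of E1:
`germRotAt_of_latticeWardAt`). -/
theorem osDataWithGap_of_legs (r : LatticeRep G) (a : ℝ → ℝ) (hapos : ∀ β, 0 < a β)
    (ha0 : Tendsto a atTop (𝓝 0)) (hUV : UV G r a) (hNT : NT G r a) (hIR : IR G r a) (hROT : ROT G r a) :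
    ∃ (sch : SpeciesScheme (YMSpecies G)) (T : OSData (YMSpecies G) 4),
      (∀ k, sch.a k = a (sch.β k)) ∧ sch.HasWeakCouplingLimit ∧ IsYangMillsFor r sch T ∧
        T.IsNontrivial r.curvature ∧ T.IsNonGaussian r.curvature ∧
        ∃ Δ > 0, T.HasMassGap Δ ∧ HasLatticeMassGap r sch Δ := by
  refine osDataWithGap_of_legs_germ r a hapos ha0 hUV hNT hIR fun sch S₁ Tq K b₀ g hB hdens => ?_
  obtain ⟨⟨hunits, -, -, hβ, -, -, -, -, -, -, -, -, -, -, -, -, hranges, -⟩, -⟩ := id hB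
  obtain ⟨r₀, hr₀, hW⟩ := hROT sch hunits hβ hranges
  exact germRotAt_of_latticeWardAt r a sch S₁ Tq K b₀ g hB hdens hr₀ hW

/-- **OS data with BOTH gaps from the four lattice legs `UV ∧ NT ∧ IR ∧ KING Θ`** for any set of angles `Θ`
generating a dense subgroup (King's finite-angle form of E1: `King.germRotAt_of_latticeKingAt`). -/
theorem osDataWithGap_of_legs_king (r : LatticeRep G) (a : ℝ → ℝ) (hapos : ∀ β, 0 < a β)
    (ha0 : Tendsto a atTop (𝓝 0)) {Θ : Set ℝ} (hΘ : Dense ((AddSubgroup.closure Θ : AddSubgroup ℝ) : Set ℝ))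
    (hUV : UV G r a) (hNT : NT G r a) (hIR : IR G r a) (hKING : KING G r a Θ) :
    ∃ (sch : SpeciesScheme (YMSpecies G)) (T : OSData (YMSpecies G) 4),
      (∀ k, sch.a k = a (sch.β k)) ∧ sch.HasWeakCouplingLimit ∧ IsYangMillsFor r sch T ∧
        T.IsNontrivial r.curvature ∧ T.IsNonGaussian r.curvature ∧
        ∃ Δ > 0, T.HasMassGap Δ ∧ HasLatticeMassGap r sch Δ := by
  refine osDataWithGap_of_legs_germ r a hapos ha0 hUV hNT hIR fun sch S₁ Tq K b₀ g hB hdens => ?_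
  obtain ⟨⟨hunits, -, -, hβ, -, -, -, -, -, -, -, -, -, -, -, -, hranges, -⟩, -⟩ := id hB
  obtain ⟨r₀, hr₀, hW⟩ := hKING sch hunits hβ hranges
  exact King.germRotAt_of_latticeKingAt r a sch S₁ Tq K b₀ g hB hdens hr₀ hΘ hW

end OneGroup

/-! ## The bridge to the Clay decl -/

/-- **`YangMills ⇐ UV ∧ NT ∧ IR ∧ ROT`** — for every compact simple `G` (Borel σ-algebra) SOME lattice representation
`r` and SOME positive unit map `a → 0` carrying the four lattice legs; conclusion: the tree's `_root_.YangMills`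
literally (scheme with `β_k → ∞`, `IsYangMillsFor`, `IsNontrivial`, `IsNonGaussian`, `T.HasMassGap Δ ∧
HasLatticeMassGap r sch Δ` at one `Δ > 0`).  Simplicity of `G` is not used by the glue: it enters only through
whoever delivers the legs. -/
theorem yangMills_of_legs
    (h : ∀ (G : Type) [Group G] [TopologicalSpace G] [IsTopologicalGroup G] [CompactSpace G],
      IsCompactSimpleLieGroup G → letI : MeasurableSpace G := borel G; haveI : BorelSpace G := ⟨rfl⟩;
      ∃ (r : LatticeRep G) (a : ℝ → ℝ), (∀ β, 0 < a β) ∧ Tendsto a atTop (𝓝 0) ∧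
        UV G r a ∧ NT G r a ∧ IR G r a ∧ ROT G r a) :
    YangMills := by
  intro G _ _ _ _ hG
  letI : MeasurableSpace G := borel G
  haveI : BorelSpace G := ⟨rfl⟩
  obtain ⟨r, a, hapos, ha0, hUV, hNT, hIR, hROT⟩ := h G hG
  obtain ⟨sch, T, -, hβ, hYM, hnt, hng, Δ, hΔ, hgap, hlat⟩ :=
    osDataWithGap_of_legs r a hapos ha0 hUV hNT hIR hROT
  exact ⟨r, sch, T, hβ, hYM, hnt, hng, Δ, hΔ, hgap, hlat⟩

/-- **`YangMills ⇐ UV ∧ NT ∧ IR ∧ KING Θ`** — the same bridge with E1 in King's finite-angle lattice form, for any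
set of angles `Θ` (chosen per group) generating a dense subgroup of `ℝ`. -/
theorem yangMills_of_legs_king
    (h : ∀ (G : Type) [Group G] [TopologicalSpace G] [IsTopologicalGroup G] [CompactSpace G],
      IsCompactSimpleLieGroup G → letI : MeasurableSpace G := borel G; haveI : BorelSpace G := ⟨rfl⟩;
      ∃ (r : LatticeRep G) (a : ℝ → ℝ) (Θ : Set ℝ), Dense ((AddSubgroup.closure Θ : AddSubgroup ℝ) : Set ℝ) ∧
        (∀ β, 0 < a β) ∧ Tendsto a atTop (𝓝 0) ∧ UV G r a ∧ NT G r a ∧ IR G r a ∧ KING G r a Θ) :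
    YangMills := by
  intro G _ _ _ _ hG
  letI : MeasurableSpace G := borel G
  haveI : BorelSpace G := ⟨rfl⟩
  obtain ⟨r, a, Θ, hΘ, hapos, ha0, hUV, hNT, hIR, hKING⟩ := h G hG
  obtain ⟨sch, T, -, hβ, hYM, hnt, hng, Δ, hΔ, hgap, hlat⟩ :=
    osDataWithGap_of_legs_king r a hapos ha0 hΘ hUV hNT hIR hKING
  exact ⟨r, sch, T, hβ, hYM, hnt, hng, Δ, hΔ, hgap, hlat⟩

/-- **`YangMills ⇐ UV ∧ NT ∧ IR ∧ KING(Pythagorean angles)`** — King's own angle set (rational points of the circle,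
`King.dense_pythagoreanAngles`). -/
theorem yangMills_of_legs_kingPyth
    (h : ∀ (G : Type) [Group G] [TopologicalSpace G] [IsTopologicalGroup G] [CompactSpace G],
      IsCompactSimpleLieGroup G → letI : MeasurableSpace G := borel G; haveI : BorelSpace G := ⟨rfl⟩;
      ∃ (r : LatticeRep G) (a : ℝ → ℝ), (∀ β, 0 < a β) ∧ Tendsto a atTop (𝓝 0) ∧
        UV G r a ∧ NT G r a ∧ IR G r a ∧ KING G r a (King.pythagoreanAngles : Set ℝ)) :
    YangMills := by
  refine yangMills_of_legs_king fun G _ _ _ _ hG => ?_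
  obtain ⟨r, a, hapos, ha0, hUV, hNT, hIR, hKING⟩ := h G hG
  exact ⟨r, a, _, King.dense_closure_pythagoreanAngles, hapos, ha0, hUV, hNT, hIR, hKING⟩

/-- **Sanity (units clause kept)**: the scheme produced runs in the units of the given map, `a_k = a(β_k)` —
so a deliverer of `IR` at rate `c₁` in units `a` yields a physical gap `≥ min(rope rate, c₁-derived rate)`;
recorded as a separate statement for the memo's §5 table. -/
theorem scheme_in_units_of_legs {G : Type} [Group G] [TopologicalSpace G] [IsTopologicalGroup G] [CompactSpace G]
    [MeasurableSpace G] [BorelSpace G] (r : LatticeRep G) (a : ℝ → ℝ) (hapos : ∀ β, 0 < a β)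
    (ha0 : Tendsto a atTop (𝓝 0)) (hUV : UV G r a) (hNT : NT G r a) (hIR : IR G r a) (hROT : ROT G r a) :
    ∃ (sch : SpeciesScheme (YMSpecies G)), (∀ k, sch.a k = a (sch.β k)) ∧ sch.HasWeakCouplingLimit ∧
      ∃ (T : OSData (YMSpecies G) 4), IsYangMillsFor r sch T ∧ ∃ Δ > 0, T.HasMassGap Δ ∧ HasLatticeMassGap r sch Δ := by
  obtain ⟨sch, T, hu, hβ, hYM, -, -, Δ, hΔ, hgap, hlat⟩ := osDataWithGap_of_legs r a hapos ha0 hUV hNT hIR hROT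
  exact ⟨sch, hu, hβ, T, hYM, Δ, hΔ, hgap, hlat⟩

/-! ## §Seq  SEQUENTIAL LEGS: the IR leg along ONE tuned sequence (memo F-k; HOME `ROUTE-P2-SketchSeq.lean`, g7) -/

section Seq

variable (G : Type) [Group G] [TopologicalSpace G] [IsTopologicalGroup G] [CompactSpace G]
  [MeasurableSpace G] [BorelSpace G] (r : LatticeRep G)

/-- **IR ALONG ONE SEQUENCE.**  Bare couplings `βseq K` and units `aseq K` (`K`: depth of the tuned sequence); ONE rate
`c₁ > 0`; for all gauge-invariant local species `A, B` a constant `C` such that for all `K ≥ K₂`, all tori `2S+1` with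
`S ≥ S₁ K` and separations `n ≤ S`: `|corr_{βseq K}(A, B; n)| ≤ C e^{−c₁ · aseq K · n}` — the tree's `GapInUnits` read
along the sequence. -/
def GapInUnitsSeq (βseq : ℕ → ℝ) (aseq : ℕ → ℝ) : Prop :=
  ∃ (c₁ : ℝ) (K₂ : ℕ) (S₁ : ℕ → ℕ), 0 < c₁ ∧ ∀ A B : YMSpecies G, ∃ C : ℝ, ∀ K : ℕ, K₂ ≤ K → ∀ S n : ℕ, S₁ K ≤ S →
    n ≤ S → |latticeConnectedCorr r.ρ (βseq K) (2 * S + 1) A.F B.F n| ≤ C * Real.exp (-(c₁ * aseq K * n))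

variable {G r}

/-- ★ **`GapInUnits ⇒ GapInUnitsSeq`** along every sequence of bare couplings that is eventually `≥` every threshold
(e.g. `βseq → ∞`), with units `aseq = a ∘ βseq`, the SAME rate `c₁` and the SAME species constants. -/
theorem gapInUnitsSeq_of_gapInUnits {a : ℝ → ℝ} (h : GapInUnits G r a) {βseq : ℕ → ℝ}
    (hβ : Tendsto βseq atTop atTop) : GapInUnitsSeq G r βseq (a ∘ βseq) := by
  obtain ⟨c₁, β₂, S₁, hc₁, hAB⟩ := h
  obtain ⟨K₂, hK₂⟩ := (tendsto_atTop_atTop.1 hβ) β₂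
  refine ⟨c₁, K₂, fun K => S₁ (βseq K), hc₁, fun A B => ?_⟩
  obtain ⟨C, hC⟩ := hAB A B
  exact ⟨C, fun K hK S n hS hn => hC (βseq K) (hK₂ K hK) S n hS hn⟩

/-- The sequential form is what a per-sequence deliverer produces: e.g. from a family of per-`K` statements with a common
rate and common species constants (the shape of the apex's conclusions, one tuned sequence at a time). -/
theorem gapInUnitsSeq_of_forall {βseq aseq : ℕ → ℝ} {c₁ : ℝ} (hc₁ : 0 < c₁) (S₁ : ℕ → ℕ) (K₂ : ℕ)
    (h : ∀ A B : YMSpecies G, ∃ C : ℝ, ∀ K : ℕ, K₂ ≤ K → ∀ S n : ℕ, S₁ K ≤ S → n ≤ S →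
      |latticeConnectedCorr r.ρ (βseq K) (2 * S + 1) A.F B.F n| ≤ C * Real.exp (-(c₁ * aseq K * n))) :
    GapInUnitsSeq G r βseq aseq :=
  ⟨c₁, K₂, S₁, hc₁, h⟩

end Seq

end Summit.QuantumFields.YangMills.Cruxes.OSLegsAtWeakCouplingC.Y2Bridge

end
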